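import Mathlib.Data.Nat.Choose.Basic
import Mathlib.Algebra.BigOperators.Intervals
import Mathlib.Algebra.Order.BigOperators.Group.Finset
import Mathlib.Tactic
import HarnessLib

/-!
# The MASTER IDENTITY of the CORE-LEMMA proof (abstract form and its binomial instances)

Support file for the Sahi / Conjecture-P programme of route `PercNearOneGluingNoHeavy`
(`--supports stmt-CriticalPhenomena-4575`, prover prim-l12-p5 gen 27; proof notes
`prim-l12-p5/CORE-g26.md` §5.1 and `prim-l12-p5/PROOF-DF1-g26.md` §3.1).
No definitions, no named facts, no sorries.

Setting (note §3.1, §5.1).  With hits `h_b`, unhits `u_b`, `h_b + u_b = n_b = 2m_b - 1` (`m₁ = a+1`,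
`m₂ = c+1`), `s` anchors and the buffer `B(i) = C(h+2s-2, i+s-1)`, the fixed-hit-set sums are
`S(α,γ) = ∑_{i,j} C(h₁,i)C(u₁,α-i)·C(h₂,j)C(u₂,γ-j)·B(i+j)` and the CORE LEMMA is
`D := (ν+1)S(a+1,c+1) - νS(a+1,c) ≥ 0`, `ν = a+c+s`.  The MASTER IDENTITY rewrites `4(u₁+1)(u₂+1)D`
as `∑ W(i,j)·[(u₁+1)(u₂+1) + (2ν+1)(2i-h₁)(2j-h₂)]` with
`W(i,j) = C(h₁,i)C(u₁+1,a+1-i)·C(h₂,j)C(u₂+1,c+1-j)·B(i+j)`.  Its proof uses only: the reflection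
symmetries of `C(h_b,·)` and `B`, the exchange `C(u₁,a+1-(h₁-i)) = C(u₁,a-i)` (complementation
`S(a+1,c) = S(a,c+1)`), and two one-line binomial identities.  Accordingly this file proves

* `sum_reflect₂`, `sum_eq_zero_of_odd₂` : double reflection on `range(h₁+1) × range(h₂+1)`;
* `master_abstract` : the identity for abstract weights `η_b, p, p', P, q, q', Q, B` subject to exactly
  those hypotheses (any real `ν`, `U₁`, `U₂`);
* `p_reflect`, `P_reflect`, `eta_reflect`, `B_reflect`, `R2`, `R3` : the hypotheses for the guarded
  binomial weights of the note (`ℕ`-subtraction guarded by `if`).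
-/

namespace Summit.CriticalPhenomena.PercolationContinuityZ3.Theorems

namespace CoreMaster

open Finset

/-! ### Double reflection over a product of two ranges -/

/-- Double reflection `(i,j) ↦ (h₁-i, h₂-j)` of a sum over `range (h₁+1) × range (h₂+1)`. -/
theorem sum_reflect₂ (h₁ h₂ : ℕ) (f : ℕ → ℕ → ℝ) :
    ∑ i ∈ range (h₁ + 1), ∑ j ∈ range (h₂ + 1), f (h₁ - i) (h₂ - j) =
      ∑ i ∈ range (h₁ + 1), ∑ j ∈ range (h₂ + 1), f i j := by
  rw [← sum_range_reflect (fun i => ∑ j ∈ range (h₂ + 1), f i j) (h₁ + 1)]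
  refine sum_congr rfl fun i _ => ?_
  simp only [add_tsub_cancel_right]
  rw [← sum_range_reflect (fun j => f (h₁ - i) j) (h₂ + 1)]
  refine sum_congr rfl fun j _ => ?_
  simp only [add_tsub_cancel_right]

/-- A sum over the product of two ranges whose summand is odd under the double reflection vanishes. -/
theorem sum_eq_zero_of_odd₂ (h₁ h₂ : ℕ) (f : ℕ → ℕ → ℝ)
    (hodd : ∀ i ≤ h₁, ∀ j ≤ h₂, f (h₁ - i) (h₂ - j) = -f i j) :
    ∑ i ∈ range (h₁ + 1), ∑ j ∈ range (h₂ + 1), f i j = 0 := by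
  have h := sum_reflect₂ h₁ h₂ f
  have h2 : ∑ i ∈ range (h₁ + 1), ∑ j ∈ range (h₂ + 1), f (h₁ - i) (h₂ - j) =
      -∑ i ∈ range (h₁ + 1), ∑ j ∈ range (h₂ + 1), f i j := by
    rw [← sum_neg_distrib]
    refine sum_congr rfl fun i hi => ?_
    rw [← sum_neg_distrib]
    refine sum_congr rfl fun j hj => ?_
    have hi' : i ≤ h₁ := by
      have := mem_range.mp hi
      omega
    have hj' : j ≤ h₂ := by
      have := mem_range.mp hj
      omega
    exact hodd i hi' j hj'
  linarith

/-! ### The abstract MASTER IDENTITY -/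

/-- **MASTER IDENTITY, abstract form (note §5.1 / (3.1)).**  Data: symmetric hit weights `η₁, η₂`
on `[0,h₁], [0,h₂]`, a buffer `B` symmetric about `(h₁+h₂)/2`, 'unhit' weights `p, p', P` (block 1)
and `q, q', Q` (block 2) exchanged by the reflection (`p(h₁-i) = p'(i)`, `P(h₁-i) = P(i)`, same for
`q, q', Q`) and satisfying the two binomial identities
`2U₁((ν+1)p(i) - νp'(i)) = P(i)((2ν+1)(2i-h₁) + U₁)` and `2U₂ q(j) = Q(j)((2j-h₂) + U₂)`.
Then, with `S(p,q) = ∑∑ η₁(i)p(i) η₂(j)q(j) B(i+j)`,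
`4U₁U₂((ν+1)S(p,q) - νS(p,q')) = ∑∑ η₁(i)P(i)η₂(j)Q(j)B(i+j)(U₁U₂ + (2ν+1)(2i-h₁)(2j-h₂))`.
(Complementation gives `S(p,q') = S(p',q)`; the cross terms are odd under the double reflection.)
In the note: `η_b = C(h_b,·)`, `p, p', P = C(u₁,a+1-·), C(u₁,a-·), C(u₁+1,a+1-·)`,
`q, q', Q = C(u₂,c+1-·), C(u₂,c-·), C(u₂+1,c+1-·)`, `B = C(h+2s-2, ·+s-1)`, `U_b = u_b+1`, `ν = n+s`,
so that the left side is `4(u₁+1)(u₂+1)·D`. -/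
theorem master_abstract (h₁ h₂ : ℕ) (η₁ η₂ p p' P q q' Q B : ℕ → ℝ) (U₁ U₂ ν : ℝ)
    (hη₁ : ∀ i ≤ h₁, η₁ (h₁ - i) = η₁ i) (hη₂ : ∀ j ≤ h₂, η₂ (h₂ - j) = η₂ j)
    (hB : ∀ i ≤ h₁ + h₂, B (h₁ + h₂ - i) = B i)
    (hp : ∀ i ≤ h₁, p (h₁ - i) = p' i) (hP : ∀ i ≤ h₁, P (h₁ - i) = P i)
    (hq : ∀ j ≤ h₂, q (h₂ - j) = q' j) (hQ : ∀ j ≤ h₂, Q (h₂ - j) = Q j)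
    (hR2 : ∀ i ≤ h₁, 2 * U₁ * ((ν + 1) * p i - ν * p' i) =
      P i * ((2 * ν + 1) * (2 * (i : ℝ) - h₁) + U₁))
    (hR3 : ∀ j ≤ h₂, 2 * U₂ * q j = Q j * ((2 * (j : ℝ) - h₂) + U₂)) :
    4 * U₁ * U₂ * ((ν + 1) * ∑ i ∈ range (h₁ + 1), ∑ j ∈ range (h₂ + 1),
          η₁ i * p i * (η₂ j * q j) * B (i + j) -
        ν * ∑ i ∈ range (h₁ + 1), ∑ j ∈ range (h₂ + 1),
          η₁ i * p i * (η₂ j * q' j) * B (i + j)) =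
      ∑ i ∈ range (h₁ + 1), ∑ j ∈ range (h₂ + 1),
        η₁ i * P i * (η₂ j * Q j) * B (i + j) *
          (U₁ * U₂ + (2 * ν + 1) * ((2 * (i : ℝ) - h₁) * (2 * (j : ℝ) - h₂))) := by
  -- (ii) complementation: S(p,q') = S(p',q)
  have hcomp : ∑ i ∈ range (h₁ + 1), ∑ j ∈ range (h₂ + 1), η₁ i * p i * (η₂ j * q' j) * B (i + j) =
      ∑ i ∈ range (h₁ + 1), ∑ j ∈ range (h₂ + 1), η₁ i * p' i * (η₂ j * q j) * B (i + j) := by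
    rw [← sum_reflect₂ h₁ h₂ (fun i j => η₁ i * p i * (η₂ j * q' j) * B (i + j))]
    refine sum_congr rfl fun i hi => sum_congr rfl fun j hj => ?_
    have hi' : i ≤ h₁ := by
      have := mem_range.mp hi
      omega
    have hj' : j ≤ h₂ := by
      have := mem_range.mp hj
      omega
    have hq' : q' (h₂ - j) = q j := by
      have := hq (h₂ - j) (by omega)
      rw [show h₂ - (h₂ - j) = j by omega] at this
      exact this.symm
    have hBij : B (h₁ - i + (h₂ - j)) = B (i + j) := by
      rw [show h₁ - i + (h₂ - j) = h₁ + h₂ - (i + j) by omega]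
      exact hB (i + j) (by omega)
    rw [hη₁ i hi', hη₂ j hj', hp i hi', hq', hBij]
  rw [hcomp]
  -- (iii) termwise: 4 U₁ U₂ ((ν+1) p q - ν p' q) = P Q ((2ν+1)(2i-h₁)+U₁)((2j-h₂)+U₂)
  have hterm : 4 * U₁ * U₂ * ((ν + 1) * ∑ i ∈ range (h₁ + 1), ∑ j ∈ range (h₂ + 1),
          η₁ i * p i * (η₂ j * q j) * B (i + j) -
        ν * ∑ i ∈ range (h₁ + 1), ∑ j ∈ range (h₂ + 1),
          η₁ i * p' i * (η₂ j * q j) * B (i + j)) =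
      ∑ i ∈ range (h₁ + 1), ∑ j ∈ range (h₂ + 1),
        η₁ i * P i * (η₂ j * Q j) * B (i + j) *
          (((2 * ν + 1) * (2 * (i : ℝ) - h₁) + U₁) * ((2 * (j : ℝ) - h₂) + U₂)) := by
    rw [mul_sum, mul_sum, ← sum_sub_distrib, mul_sum]
    refine sum_congr rfl fun i hi => ?_
    rw [mul_sum, mul_sum, ← sum_sub_distrib, mul_sum]
    refine sum_congr rfl fun j hj => ?_
    have hi' : i ≤ h₁ := by
      have := mem_range.mp hi
      omega
    have hj' : j ≤ h₂ := by
      have := mem_range.mp hj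
      omega
    have e2 := hR2 i hi'
    have e3 := hR3 j hj'
    -- 4U₁U₂((ν+1)p q − ν p' q) = [2U₁((ν+1)p − νp')]·[2U₂ q]
    calc 4 * U₁ * U₂ * ((ν + 1) * (η₁ i * p i * (η₂ j * q j) * B (i + j)) -
          ν * (η₁ i * p' i * (η₂ j * q j) * B (i + j)))
        = η₁ i * η₂ j * B (i + j) * ((2 * U₁ * ((ν + 1) * p i - ν * p' i)) * (2 * U₂ * q j)) := by
          ring
      _ = η₁ i * η₂ j * B (i + j) *
          ((P i * ((2 * ν + 1) * (2 * (i : ℝ) - h₁) + U₁)) * (Q j * ((2 * (j : ℝ) - h₂) + U₂))) := by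
          rw [e2, e3]
      _ = η₁ i * P i * (η₂ j * Q j) * B (i + j) *
          (((2 * ν + 1) * (2 * (i : ℝ) - h₁) + U₁) * ((2 * (j : ℝ) - h₂) + U₂)) := by ring
  rw [hterm]
  -- (iv) the cross terms are odd, hence vanish
  have hX₁ : ∑ i ∈ range (h₁ + 1), ∑ j ∈ range (h₂ + 1),
      η₁ i * P i * (η₂ j * Q j) * B (i + j) * (2 * (i : ℝ) - h₁) = 0 := by
    refine sum_eq_zero_of_odd₂ h₁ h₂ _ fun i hi j hj => ?_
    have hBij : B (h₁ - i + (h₂ - j)) = B (i + j) := by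
      rw [show h₁ - i + (h₂ - j) = h₁ + h₂ - (i + j) by omega]
      exact hB (i + j) (by omega)
    rw [hη₁ i hi, hη₂ j hj, hP i hi, hQ j hj, hBij]
    push_cast [Nat.cast_sub hi]
    ring
  have hX₂ : ∑ i ∈ range (h₁ + 1), ∑ j ∈ range (h₂ + 1),
      η₁ i * P i * (η₂ j * Q j) * B (i + j) * (2 * (j : ℝ) - h₂) = 0 := by
    refine sum_eq_zero_of_odd₂ h₁ h₂ _ fun i hi j hj => ?_
    have hBij : B (h₁ - i + (h₂ - j)) = B (i + j) := by
      rw [show h₁ - i + (h₂ - j) = h₁ + h₂ - (i + j) by omega]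
      exact hB (i + j) (by omega)
    rw [hη₁ i hi, hη₂ j hj, hP i hi, hQ j hj, hBij]
    push_cast [Nat.cast_sub hj]
    ring
  -- expand
  have hexp : ∀ i j : ℕ, η₁ i * P i * (η₂ j * Q j) * B (i + j) *
      (((2 * ν + 1) * (2 * (i : ℝ) - h₁) + U₁) * ((2 * (j : ℝ) - h₂) + U₂)) =
      η₁ i * P i * (η₂ j * Q j) * B (i + j) *
        (U₁ * U₂ + (2 * ν + 1) * ((2 * (i : ℝ) - h₁) * (2 * (j : ℝ) - h₂))) +
      ((2 * ν + 1) * U₂) * (η₁ i * P i * (η₂ j * Q j) * B (i + j) * (2 * (i : ℝ) - h₁)) +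
      U₁ * (η₁ i * P i * (η₂ j * Q j) * B (i + j) * (2 * (j : ℝ) - h₂)) := by
    intro i j
    ring
  simp_rw [hexp, sum_add_distrib, ← mul_sum, hX₁, hX₂]
  ring

/-! ### The binomial instances of the reflection and of the identities (R2), (R3) -/

/-- Reflection exchanges `C(u, a+1-·)` and `C(u, a-·)` on `[0,h]` when `h + u = 2a+1`. -/
theorem p_reflect (a h u i : ℕ) (hn : h + u = 2 * a + 1) (hi : i ≤ h) :
    (if h - i ≤ a + 1 then (u.choose (a + 1 - (h - i)) : ℝ) else 0) =
      (if i ≤ a then (u.choose (a - i) : ℝ) else 0) := by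
  by_cases hia : i ≤ a
  · rw [if_pos hia]
    by_cases hg : h - i ≤ a + 1
    · rw [if_pos hg, show a + 1 - (h - i) = u - (a - i) by omega, Nat.choose_symm (by omega)]
    · rw [if_neg hg, Nat.choose_eq_zero_of_lt (show u < a - i by omega)]
      simp
  · rw [if_neg hia, if_pos (show h - i ≤ a + 1 by omega),
      Nat.choose_eq_zero_of_lt (show u < a + 1 - (h - i) by omega)]
    simp

/-- Reflection invariance of `C(u+1, a+1-·)` on `[0,h]` when `h + u = 2a+1`. -/
theorem P_reflect (a h u i : ℕ) (hn : h + u = 2 * a + 1) (hi : i ≤ h) :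
    (if h - i ≤ a + 1 then ((u + 1).choose (a + 1 - (h - i)) : ℝ) else 0) =
      (if i ≤ a + 1 then ((u + 1).choose (a + 1 - i) : ℝ) else 0) := by
  by_cases hia : i ≤ a + 1
  · rw [if_pos hia]
    by_cases hg : h - i ≤ a + 1
    · rw [if_pos hg, show a + 1 - (h - i) = (u + 1) - (a + 1 - i) by omega,
        Nat.choose_symm (by omega)]
    · rw [if_neg hg, Nat.choose_eq_zero_of_lt (show u + 1 < a + 1 - i by omega)]
      simp
  · rw [if_neg hia, if_pos (show h - i ≤ a + 1 by omega),
      Nat.choose_eq_zero_of_lt (show u + 1 < a + 1 - (h - i) by omega)]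
    simp

/-- The symmetric hit weight. -/
theorem eta_reflect (h i : ℕ) (hi : i ≤ h) : ((h.choose (h - i) : ℕ) : ℝ) = (h.choose i : ℝ) := by
  rw [Nat.choose_symm hi]

/-- Reflection invariance of the guarded buffer `B(i) = C(h+2s-2, i+s-1)` (`0` if `i+s = 0`). -/
theorem B_reflect (h s i : ℕ) (hhs : 2 ≤ h + 2 * s) (hi : i ≤ h) :
    (if 1 ≤ h - i + s then ((h + 2 * s - 2).choose (h - i + s - 1) : ℝ) else 0) =
      (if 1 ≤ i + s then ((h + 2 * s - 2).choose (i + s - 1) : ℝ) else 0) := by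
  by_cases g1 : 1 ≤ i + s
  · rw [if_pos g1]
    by_cases g2 : 1 ≤ h - i + s
    · rw [if_pos g2, show h - i + s - 1 = (h + 2 * s - 2) - (i + s - 1) by omega,
        Nat.choose_symm (by omega)]
    · rw [if_neg g2, Nat.choose_eq_zero_of_lt (show h + 2 * s - 2 < i + s - 1 by omega)]
      simp
  · rw [if_neg g1]
    by_cases g2 : 1 ≤ h - i + s
    · rw [if_pos g2, Nat.choose_eq_zero_of_lt (show h + 2 * s - 2 < h - i + s - 1 by omega)]
      simp
    · rw [if_neg g2]

/-- Identity (R2): `2(u+1)((ν+1)C(u,a+1-i) - νC(u,a-i)) = C(u+1,a+1-i)((2ν+1)(2i-h) + u+1)`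
for `h + u = 2a+1`, `i ≤ h` (guarded binomials). -/
theorem R2 (a h u i : ℕ) (ν : ℝ) (hn : h + u = 2 * a + 1) (hi : i ≤ h) :
    2 * ((u : ℝ) + 1) * ((ν + 1) * (if i ≤ a + 1 then (u.choose (a + 1 - i) : ℝ) else 0) -
        ν * (if i ≤ a then (u.choose (a - i) : ℝ) else 0)) =
      (if i ≤ a + 1 then ((u + 1).choose (a + 1 - i) : ℝ) else 0) *
        ((2 * ν + 1) * (2 * (i : ℝ) - h) + ((u : ℝ) + 1)) := by
  have hnr : (h : ℝ) + u = 2 * a + 1 := by exact_mod_cast hn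
  by_cases hia : i ≤ a
  · rw [if_pos (show i ≤ a + 1 by omega), if_pos hia, if_pos (show i ≤ a + 1 by omega)]
    rcases le_or_gt (a + 1 - i) (u + 1) with hk | hk
    · have h1 := Nat.choose_mul_succ_eq u (a + 1 - i)
      have h2 := Nat.add_one_mul_choose_eq u (a - i)
      rw [show a - i + 1 = a + 1 - i by omega] at h2
      have hc1 : ((u.choose (a + 1 - i) * (u + 1) : ℕ) : ℝ) =
          (((u + 1).choose (a + 1 - i) * (u + 1 - (a + 1 - i)) : ℕ) : ℝ) := by rw [h1]
      have hc2 : (((u + 1) * u.choose (a - i) : ℕ) : ℝ) =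
          (((u + 1).choose (a + 1 - i) * (a + 1 - i) : ℕ) : ℝ) := by rw [h2]
      push_cast [Nat.cast_sub hk, Nat.cast_sub (show i ≤ a + 1 by omega)] at hc1 hc2
      linear_combination (2 * (ν + 1)) * hc1 - (2 * ν) * hc2 +
        ((2 * ν + 1) * ((u + 1).choose (a + 1 - i) : ℝ)) * hnr
    · rw [Nat.choose_eq_zero_of_lt (show u < a + 1 - i by omega),
        Nat.choose_eq_zero_of_lt (show u + 1 < a + 1 - i by omega),
        Nat.choose_eq_zero_of_lt (show u < a - i by omega)]
      simp
  · by_cases hia1 : i ≤ a + 1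
    · have hieq : i = a + 1 := by omega
      subst hieq
      rw [if_pos le_rfl, if_neg hia, if_pos le_rfl]
      simp only [Nat.sub_self, Nat.choose_zero_right, Nat.cast_one]
      push_cast
      linear_combination (2 * ν + 1) * hnr
    · rw [if_neg hia1, if_neg hia, if_neg hia1]
      simp

/-- Identity (R3): `2(u+1)C(u,c+1-j) = C(u+1,c+1-j)((2j-h) + u+1)` for `h + u = 2c+1`, `j ≤ h`. -/
theorem R3 (c h u j : ℕ) (hn : h + u = 2 * c + 1) :
    2 * ((u : ℝ) + 1) * (if j ≤ c + 1 then (u.choose (c + 1 - j) : ℝ) else 0) =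
      (if j ≤ c + 1 then ((u + 1).choose (c + 1 - j) : ℝ) else 0) *
        ((2 * (j : ℝ) - h) + ((u : ℝ) + 1)) := by
  have hnr : (h : ℝ) + u = 2 * c + 1 := by exact_mod_cast hn
  by_cases hjc : j ≤ c + 1
  · rw [if_pos hjc, if_pos hjc]
    rcases le_or_gt (c + 1 - j) (u + 1) with hk | hk
    · have h1 := Nat.choose_mul_succ_eq u (c + 1 - j)
      have hc1 : ((u.choose (c + 1 - j) * (u + 1) : ℕ) : ℝ) =
          (((u + 1).choose (c + 1 - j) * (u + 1 - (c + 1 - j)) : ℕ) : ℝ) := by rw [h1]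
      push_cast [Nat.cast_sub hk, Nat.cast_sub hjc] at hc1
      linear_combination 2 * hc1 + ((u + 1).choose (c + 1 - j) : ℝ) * hnr
    · rw [Nat.choose_eq_zero_of_lt (show u < c + 1 - j by omega),
        Nat.choose_eq_zero_of_lt (show u + 1 < c + 1 - j by omega)]
      simp
  · rw [if_neg hjc, if_neg hjc]
    simp

end CoreMaster

end Summit.CriticalPhenomena.PercolationContinuityZ3.Theorems
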